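import Literature.Geometry.Lorentzian.CoordTensorWaveUniqueness
import Literature.Geometry.Lorentzian.CoordTensorWaveOpLinear
import Literature.Geometry.Lorentzian.CoordMetricCutoff
import Literature.Geometry.Lorentzian.SliceFlatCoefficients
import Literature.Analysis.PDE.LinearWaveSystemFriedrichs
import Literature.Analysis.Matrix.SmoothCholesky3
import HarnessLib

/-!
# Local existence for linear tensor wave equations near a point of a spacelike slice

Coordinate-components file (everything proved; no named facts). Let `G` be smooth, symmetric and
nondegenerate components of a metric on an open set `T ⊆ ℝ × ℝ³` and let `(0, x₀) ∈ T` be a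
point at which `G` is slice-hyperbolic (`g⁰⁰ < 0`, positive-definite spatial symbol). Then
(`IsMetricOn.exists_tensorWave_solution`) there is `r > 0` with `B((0,x₀), r) ⊆ T` such that for
all `C_c^∞` Cauchy data `(S₀, S₁)` (components of a covariant tensor of any rank `α`) there is a
smooth tensor field `S` on `ℝ × ℝ³` with `S(0,·) = S₀`, `∂_t S(0,·) = S₁`, solving the tensor wave
equation `□_G S = 0` on a neighbourhood of every point `(0, y)` of the slice ball `B((0,x₀), r)`.

The proof is the localisation of Friedrichs' theorem (Hawking–Ellis 1973, §7.4–7.5; Friedrichs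
1954; John 1982, Ch. 5 §3):
* cut `G` off to a smooth slice-hyperbolic field `Ĝ` on the whole space, equal to `G` on
  `B((0,x₀), r)` and constant far out (`IsMetricOn.exists_sliceHyperbolic_cutoff`);
* the components of `□_Ĝ S = 0` are a diagonal second-order system with the principal part of
  `Ĝ` and first-order coupling through the explicit coefficients `lowerCoef0`, `lowerCoef1` of
  `CoordTensorWaveOpLinear.lean` (`tlap_eq_P_add_cpl`), i.e. a `WaveSystem.Coeffs` (`waveCoeffs`:
  `a = −ĝ⁰⁰`, `βʲ = ĝ^{0j}/a`, `Q = ` spatial symbol, `h = (ĝ_{jk})` by the Schur complement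
  identity, `e = ` the Cholesky frame of `Q`), smooth (`isSmooth_waveCoeffs`) and constant far out,
  hence regular admissible (`isRegularSymmCoeffFamily_of_flat`);
* Friedrichs' theorem in the form `WaveSystem.exists_solution` gives the smooth solution with the
  data, and `□_G = □_Ĝ` near the slice ball (`tlap_congr_of_eqOn`).

## References

* S. W. Hawking, G. F. R. Ellis, *The large scale structure of space-time*, CUP 1973, §7.4–7.5.
  [HawkingEllis1973CUP]
* K. O. Friedrichs, *Symmetric hyperbolic linear differential equations*, CPAM 7 (1954).
  [Friedrichs1954]
* F. John, *Partial differential equations*, 4th ed., Springer 1982, Ch. 5 §3. [John1982]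
-/

noncomputable section

-- instance search through nested operator types `E →L E →L ℝ`
set_option maxSynthPendingDepth 3

open Set Filter ContinuousLinearMap Module Function Metric
open scoped Topology ContDiff RealInnerProductSpace

namespace Literature.Geometry.Lorentzian

namespace MetricCoord

open Literature.Analysis.PDE Literature.Analysis.PDE.VarWave Literature.Analysis.PDE.WaveFrame
  Literature.Analysis.Matrix GaussSlice

/-! ### The coefficient data of the component system of `□_Ĝ S = 0` -/

section Coeffs

variable {α : Type*} [Fintype α] [DecidableEq α] (Ĝ : Pt 3 → Pt 3 →L[ℝ] Pt 3 →L[ℝ] ℝ)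

/-- **The coefficient data of the component system of `□_Ĝ S = 0`** for a rank-`α` covariant
tensor `S` in the wave basis of `ℝ × ℝ³`: `a = −ĝ⁰⁰`, `βʲ = ĝ^{0j}/a`,
`Q^{jk} = ĝ^{jk} − ĝ^{0j}ĝ^{0k}/ĝ⁰⁰`, `h_{jk} = ĝ_{jk}`, `e` the Cholesky frame of `Q`, and the
coupling coefficients `lowerCoef0`, `lowerCoef1` of the lower-order part of `□`.
[cite: John1982, Ch. 5 §3] -/
def waveCoeffs : WaveSystem.Coeffs (α → Option (Fin 3)) 3 where
  a p := -ginv Ĝ (waveBasis 3) p none none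
  β j p := ginv Ĝ (waveBasis 3) p none (some j) / -ginv Ĝ (waveBasis 3) p none none
  Q j k p := sliceQOf (waveBasis 3) (Ĝ p) j k
  h j k p := Ĝ p (waveBasis 3 (some j)) (waveBasis 3 (some k))
  e l k p := Cholesky3.cholFrame (fun j k ↦ sliceQOf (waveBasis 3) (Ĝ p) j k) l k
  c0 I J p := lowerCoef0 Ĝ (waveBasis 3) p I J
  cT I J p := lowerCoef1 Ĝ (waveBasis 3) p I none J
  cX I J j p := lowerCoef1 Ĝ (waveBasis 3) p I (some j) J

/-- The spatial symbol in terms of `ginv`. [folklore] -/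
theorem sliceQOf_eq (p : Pt 3) (j k : Fin 3) :
    sliceQOf (waveBasis 3) (Ĝ p) j k =
      ginv Ĝ (waveBasis 3) p (some j) (some k)
        - ginv Ĝ (waveBasis 3) p none (some j) * ginv Ĝ (waveBasis 3) p none (some k)
          / ginv Ĝ (waveBasis 3) p none none := rfl

variable {Ĝ}

/-- **The coefficient data are smooth admissible** for a smooth field of slice-hyperbolic forms.
[cite: John1982, Ch. 5 §3] -/
theorem isSmooth_waveCoeffs (hĜ : IsMetricOn Ĝ univ)
    (hhyp : ∀ p, IsSliceHyperbolic (waveBasis 3) (Ĝ p)) :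
    (waveCoeffs (α := α) Ĝ).IsSmooth := by
  have hginv : ∀ i j, ContDiff ℝ ∞ fun p ↦ ginv Ĝ (waveBasis 3) p i j := fun i j ↦
    contDiffOn_univ.1 (hĜ.contDiffOn_ginv (waveBasis 3) i j)
  have h00 : ∀ p, ginv Ĝ (waveBasis 3) p none none < 0 := fun p ↦ (hhyp p).g00_neg
  have ha : ContDiff ℝ ∞ fun p ↦ -ginv Ĝ (waveBasis 3) p none none := (hginv none none).neg
  have hQs : ∀ j k, ContDiff ℝ ∞ fun p ↦ sliceQOf (waveBasis 3) (Ĝ p) j k := fun j k ↦ by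
    simp only [sliceQOf_eq]
    exact (hginv _ _).sub (((hginv _ _).mul (hginv _ _)).div (hginv _ _) fun p ↦ (h00 p).ne)
  have hgs : ∀ p a c, ginv Ĝ (waveBasis 3) p a c = ginv Ĝ (waveBasis 3) p c a := fun p a c ↦
    ginv_comm (waveBasis 3) (hĜ.isInvertible p (mem_univ _)) (hĜ.symm p (mem_univ _)) a c
  have hQsym : ∀ p j k, sliceQOf (waveBasis 3) (Ĝ p) j k = sliceQOf (waveBasis 3) (Ĝ p) k j :=
    fun p j k ↦ by simp only [sliceQOf_eq, hgs p (some j) (some k)]; ring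
  have hQpd : ∀ p, Cholesky3.IsPosDef (fun j k ↦ sliceQOf (waveBasis 3) (Ĝ p) j k) := fun p ↦
    (hhyp p).posDef
  refine
    { a := ha
      apos := fun p ↦ by simp only [waveCoeffs]; linarith [h00 p]
      β := fun j ↦ (hginv _ _).div ha fun p ↦ by linarith [h00 p]
      h := fun j k ↦ ((contDiffOn_univ.1 hĜ.contDiffOn).clm_apply contDiff_const).clm_apply
        contDiff_const
      e := fun l k ↦ Cholesky3.contDiff_cholFrame hQs hQsym hQpd l k
      hQ := fun j k p ↦ Cholesky3.sum_cholFrame_mul_cholFrame (hQsym p) (hQpd p) j k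
      hinv := fun k i p ↦ ?_
      c0 := fun K J ↦ contDiffOn_univ.1 (hĜ.contDiffOn_lowerCoef0 Ĝ (waveBasis 3) K J)
      cT := fun K J ↦ contDiffOn_univ.1 (hĜ.contDiffOn_lowerCoef1 Ĝ (waveBasis 3) K none J)
      cX := fun K J j ↦ contDiffOn_univ.1 (hĜ.contDiffOn_lowerCoef1 Ĝ (waveBasis 3) K (some j) J) }
  simp only [waveCoeffs, sliceQOf_eq]
  exact sum_metric_mul_sliceQ (waveBasis 3) (hĜ.isInvertible p (mem_univ _))
    (hĜ.symm p (mem_univ _)) (h00 p).ne k i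

/-! ### The coefficient data are constant where the metric is -/

/-- Values of the coefficient data at two points where the metric has the same value agree.
[folklore] -/
theorem waveCoeffs_value_congr {p q : Pt 3} (hq : Ĝ q = Ĝ p) :
    (waveCoeffs (α := α) Ĝ).a q = (waveCoeffs (α := α) Ĝ).a p ∧
    (∀ j, (waveCoeffs (α := α) Ĝ).β j q = (waveCoeffs (α := α) Ĝ).β j p) ∧
    (∀ j k, (waveCoeffs (α := α) Ĝ).h j k q = (waveCoeffs (α := α) Ĝ).h j k p) ∧
    (∀ l k, (waveCoeffs (α := α) Ĝ).e l k q = (waveCoeffs (α := α) Ĝ).e l k p) ∧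
    (waveCoeffs (α := α) Ĝ).sa q = (waveCoeffs (α := α) Ĝ).sa p ∧
    (waveCoeffs (α := α) Ĝ).isa q = (waveCoeffs (α := α) Ĝ).isa p := by
  refine ⟨?_, fun j ↦ ?_, fun j k ↦ ?_, fun l k ↦ ?_, ?_, ?_⟩ <;>
    simp only [waveCoeffs, WaveSystem.Coeffs.sa, WaveSystem.Coeffs.isa, sliceQOf, ginvOf, sharpOf,
      ginv, sharpAt, hq]

/-- A function which is locally constant has zero derivative. [folklore] -/
theorem fderiv_eq_zero_of_eventually_eq {n : ℕ} {f : Pt n → ℝ} {p : Pt n}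
    (h : ∀ᶠ q in 𝓝 p, f q = f p) : fderiv ℝ f p = 0 := by
  rw [Filter.EventuallyEq.fderiv_eq (show f =ᶠ[𝓝 p] fun _ ↦ f p from h)]
  simp

/-- A locally constant function has `D₀ f = 0`. [folklore] -/
theorem D0_eq_zero_of_eventually_eq {n : ℕ} {β : Fin n → Pt n → ℝ} {f : Pt n → ℝ} {p : Pt n}
    (h : ∀ᶠ q in 𝓝 p, f q = f p) : D0 β f p = 0 := by
  simp [D0, VarWave.dT, VarWave.dX, fderiv_eq_zero_of_eventually_eq h]

/-- A locally constant function has `∂_k f = 0`. [folklore] -/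
theorem dX_eq_zero_of_eventually_eq {n : ℕ} {f : Pt n → ℝ} {p : Pt n}
    (h : ∀ᶠ q in 𝓝 p, f q = f p) (k : Fin n) : VarWave.dX f k p = 0 := by
  simp [VarWave.dX, fderiv_eq_zero_of_eventually_eq h]

/-- **The principal coefficients at two points near which the metric is the same constant agree.**
[folklore] -/
theorem Acoef_waveCoeffs_congr {p q : Pt 3} (hq : Ĝ q = Ĝ p) (j : Fin 3) :
    (waveCoeffs (α := α) Ĝ).Acoef j q = (waveCoeffs (α := α) Ĝ).Acoef j p := by
  obtain ⟨-, hβ, -, he, -, hisa⟩ := waveCoeffs_value_congr (α := α) (Ĝ := Ĝ) hq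
  funext σ τ
  obtain ⟨K, s⟩ := σ
  obtain ⟨J, s'⟩ := τ
  rcases s with _ | _ | l <;> rcases s' with _ | _ | l' <;>
    simp only [WaveSystem.Coeffs.Acoef, hβ, he, hisa]

/-- **The zeroth-order coefficients at two points near which the metric is the same constant
agree.** [folklore] -/
theorem Bcoef_waveCoeffs_congr {M : Pt 3 →L[ℝ] Pt 3 →L[ℝ] ℝ} {p q : Pt 3}
    (hp : Ĝ =ᶠ[𝓝 p] fun _ ↦ M) (hq : Ĝ =ᶠ[𝓝 q] fun _ ↦ M) :
    (waveCoeffs (α := α) Ĝ).Bcoef q = (waveCoeffs (α := α) Ĝ).Bcoef p := by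
  set C := waveCoeffs (α := α) Ĝ with hC
  have hpv : Ĝ p = M := hp.self_of_nhds
  have hqv : Ĝ q = M := hq.self_of_nhds
  obtain ⟨-, -, -, -, -, hisa0⟩ := waveCoeffs_value_congr (α := α) (Ĝ := Ĝ) (hqv.trans hpv.symm)
  have hisa : C.isa q = C.isa p := hisa0
  -- local constancy of the value functions near `p` and near `q`
  have hloc : ∀ {r : Pt 3}, (Ĝ =ᶠ[𝓝 r] fun _ ↦ M) →
      (∀ᶠ r' in 𝓝 r, C.sa r' = C.sa r) ∧ (∀ᶠ r' in 𝓝 r, C.isa r' = C.isa r) ∧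
      (∀ j, ∀ᶠ r' in 𝓝 r, C.β j r' = C.β j r) ∧ (∀ l k, ∀ᶠ r' in 𝓝 r, C.e l k r' = C.e l k r) := by
    intro r hr
    have hrv : Ĝ r = M := hr.self_of_nhds
    have hev : ∀ᶠ r' in 𝓝 r, Ĝ r' = Ĝ r := hr.mono fun r' h ↦ h.trans hrv.symm
    refine ⟨hev.mono fun r' h ↦ (waveCoeffs_value_congr (α := α) h).2.2.2.2.1,
      hev.mono fun r' h ↦ (waveCoeffs_value_congr (α := α) h).2.2.2.2.2,
      fun j ↦ hev.mono fun r' h ↦ (waveCoeffs_value_congr (α := α) h).2.1 j,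
      fun l k ↦ hev.mono fun r' h ↦ (waveCoeffs_value_congr (α := α) h).2.2.2.1 l k⟩
  -- the derivative terms vanish at both points
  have hzero : ∀ {r : Pt 3}, (Ĝ =ᶠ[𝓝 r] fun _ ↦ M) →
      D0 C.β C.sa r = 0 ∧ (∀ k, VarWave.dX C.isa k r = 0) ∧
      (∀ j, D0 C.β (C.β j) r = 0) ∧ (∀ j k, VarWave.dX (C.β j) k r = 0) ∧
      (∀ l k, D0 C.β (C.e l k) r = 0) ∧ (∀ l k j, VarWave.dX (C.e l k) j r = 0) ∧
      (∀ l m, Mco C.β C.h C.e l m r = 0) ∧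
      (∀ K J, C.c0 K J r = 0) ∧ (∀ K J, C.cT K J r = 0) ∧ (∀ K J j, C.cX K J j r = 0) := by
    intro r hr
    obtain ⟨hsa, hisa', hβ, he⟩ := hloc hr
    have hDe : ∀ l k, D0 C.β (C.e l k) r = 0 := fun l k ↦ D0_eq_zero_of_eventually_eq (he l k)
    have hdβ : ∀ j k, VarWave.dX (C.β j) k r = 0 := fun j k ↦ dX_eq_zero_of_eventually_eq (hβ j) k
    refine ⟨D0_eq_zero_of_eventually_eq hsa, fun k ↦ dX_eq_zero_of_eventually_eq hisa' k,
      fun j ↦ D0_eq_zero_of_eventually_eq (hβ j), hdβ, hDe,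
      fun l k j ↦ dX_eq_zero_of_eventually_eq (he l k) j, fun l m ↦ ?_,
      fun K J ↦ lowerCoef0_eq_zero_of_eventuallyEq_const (waveBasis 3) hr K J,
      fun K J ↦ lowerCoef1_eq_zero_of_eventuallyEq_const (waveBasis 3) hr K none J,
      fun K J j ↦ lowerCoef1_eq_zero_of_eventuallyEq_const (waveBasis 3) hr K (some j) J⟩
    simp [Mco, hDe, hdβ]
  obtain ⟨p1, p2, p3, p4, p5, p6, p7, p8, p9, p10⟩ := hzero hp
  obtain ⟨q1, q2, q3, q4, q5, q6, q7, q8, q9, q10⟩ := hzero hq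
  funext σ τ
  obtain ⟨K, s⟩ := σ
  obtain ⟨J, s'⟩ := τ
  rcases s with _ | _ | l <;> rcases s' with _ | _ | m <;>
    simp [WaveSystem.Coeffs.Bcoef, hisa, p1, p2, p3, p6, p7, p8, p9, p10, q1, q2, q3, q6, q7, q8,
      q9, q10]

/-- **Far-out constancy of the operator fields.** If `Ĝ` is the constant `M` outside the ball of
radius `R` around `p₀`, the operator fields `A_j`, `B` of the big first-order system are constant
in `{‖x⃗‖ > |R| + ‖p₀‖ + 1}`. [cite: Friedrichs1954, §1] -/
theorem waveCoeffs_flat {M : Pt 3 →L[ℝ] Pt 3 →L[ℝ] ℝ} {p₀ : Pt 3} {R : ℝ}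
    (hfar : ∀ p, R ≤ dist p p₀ → Ĝ p = M) :
    ∃ (cA : Fin 3 → EuclideanSpace ℝ (WaveSystem.Idx (α → Option (Fin 3)) 3) →L[ℝ]
        EuclideanSpace ℝ (WaveSystem.Idx (α → Option (Fin 3)) 3))
      (cB : EuclideanSpace ℝ (WaveSystem.Idx (α → Option (Fin 3)) 3) →L[ℝ]
        EuclideanSpace ℝ (WaveSystem.Idx (α → Option (Fin 3)) 3)),
      (∀ j (p : Pt 3), |R| + ‖p₀‖ + 1 < ‖p.2‖ → (waveCoeffs (α := α) Ĝ).Aop j p = cA j) ∧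
      (∀ p : Pt 3, |R| + ‖p₀‖ + 1 < ‖p.2‖ → (waveCoeffs (α := α) Ĝ).Bop p = cB) := by
  set C := waveCoeffs (α := α) Ĝ with hC
  -- far points: the metric is locally the constant `M`
  have hO : IsOpen {p : Pt 3 | R < dist p p₀} :=
    isOpen_lt continuous_const (continuous_id.dist continuous_const)
  have hev : ∀ p : Pt 3, R < dist p p₀ → Ĝ =ᶠ[𝓝 p] fun _ ↦ M := fun p hp ↦ by
    filter_upwards [hO.mem_nhds hp] with q hq
    exact hfar q (le_of_lt hq)
  have hfarOf : ∀ p : Pt 3, |R| + ‖p₀‖ + 1 < ‖p.2‖ → R < dist p p₀ := by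
    intro p hp
    have h1 : ‖p.2‖ ≤ ‖p‖ := norm_snd_le p
    have h2 : ‖p‖ ≤ ‖p - p₀‖ + ‖p₀‖ := norm_le_norm_sub_add p p₀
    rw [dist_eq_norm]
    linarith [le_abs_self R]
  -- a reference far point
  set pfar : Pt 3 := ((|R| + ‖p₀‖ + 2 : ℝ), (0 : EuclideanSpace ℝ (Fin 3))) with hpfar
  have hpfarR : R < dist pfar p₀ := by
    have h1 : ‖pfar.1‖ ≤ ‖pfar‖ := norm_fst_le pfar
    have h2 : ‖pfar‖ ≤ ‖pfar - p₀‖ + ‖p₀‖ := norm_le_norm_sub_add pfar p₀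
    have h3 : ‖pfar.1‖ = |R| + ‖p₀‖ + 2 := by
      simp only [hpfar, Real.norm_eq_abs]
      exact abs_of_nonneg (by positivity)
    rw [dist_eq_norm]
    linarith [le_abs_self R]
  refine ⟨fun j ↦ C.Aop j pfar, C.Bop pfar, fun j p hp ↦ ?_, fun p hp ↦ ?_⟩
  · have hq : Ĝ p = Ĝ pfar := (hev p (hfarOf p hp)).self_of_nhds.trans
      (hev pfar hpfarR).self_of_nhds.symm
    simp only [hC, WaveSystem.Coeffs.Aop, Acoef_waveCoeffs_congr hq]
  · simp only [hC, WaveSystem.Coeffs.Bop,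
      Bcoef_waveCoeffs_congr (α := α) (hev pfar hpfarR) (hev p (hfarOf p hp))]

end Coeffs

/-! ### The component system of `□_Ĝ S = 0` -/

section Equation

variable {α : Type*} [Fintype α] [DecidableEq α] {Ĝ : Pt 3 → Pt 3 →L[ℝ] Pt 3 →L[ℝ] ℝ}

/-- **`□_Ĝ` in components is the diagonal second-order system of `waveCoeffs Ĝ`**: for a smooth
family `f` of components, `(□_Ĝ S)_I = P f_I + (coupling)_I` with `S p I = f I p`, where
`P = −a ∂_t² + 2aβʲ∂_t∂_j + (Q^{jk} − aβʲβᵏ)∂_j∂_k = Σ ĝ^{μν} ∂_μ∂_ν`. [cite: John1982, Ch. 5 §3] -/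
theorem tlap_eq_P_add_cpl (hĜ : IsMetricOn Ĝ univ) (hhyp : ∀ p, IsSliceHyperbolic (waveBasis 3) (Ĝ p))
    {f : (α → Option (Fin 3)) → Pt 3 → ℝ} (hf : ∀ K, ContDiff ℝ ∞ (f K)) (p : Pt 3)
    (I : α → Option (Fin 3)) :
    tlap Ĝ (waveBasis 3) (fun q J ↦ f J q) p I =
      WaveFrame.P (waveCoeffs (α := α) Ĝ).a (waveCoeffs (α := α) Ĝ).β (waveCoeffs (α := α) Ĝ).Q
          0 0 0 (f I) p
        + (waveCoeffs (α := α) Ĝ).cpl f I p := by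
  have hS : TSmoothOn (fun q (J : α → Option (Fin 3)) ↦ f J q) univ := fun J ↦ (hf J).contDiffOn
  have h00 : ginv Ĝ (waveBasis 3) p none none ≠ 0 := (hhyp p).g00_neg.ne
  have hgs : ∀ a c, ginv Ĝ (waveBasis 3) p a c = ginv Ĝ (waveBasis 3) p c a := fun a c ↦
    ginv_comm (waveBasis 3) (hĜ.isInvertible p (mem_univ _)) (hĜ.symm p (mem_univ _)) a c
  have heta : ∀ J, (fun y ↦ f J y) = f J := fun J ↦ rfl
  rw [hĜ.tlap_eq_principal_add_lower (b := waveBasis 3) hS (mem_univ p) I]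
  simp only [heta]
  congr 1
  · -- the principal part
    have hD2 : ∀ v w, fderiv ℝ (fderiv ℝ (f I)) p v w = fderiv ℝ (fderiv ℝ (f I)) p w v := by
      intro v w
      have h := fderiv_fderiv_comm (hf I) p v w
      rw [fderiv_fderiv_apply (hf I), fderiv_fderiv_apply (hf I)] at h
      exact h.symm
    have hTT : dTT (f I) p = fderiv ℝ (fderiv ℝ (f I)) p eT eT := by
      unfold dTT VarWave.dT; rw [fderiv_fderiv_apply (hf I)]
    have hTX : ∀ j, dTX (f I) j p = fderiv ℝ (fderiv ℝ (f I)) p (eX j) eT := fun j ↦ by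
      unfold dTX VarWave.dT; rw [fderiv_fderiv_apply (hf I)]
    have hXX : ∀ j k, dXX (f I) j k p = fderiv ℝ (fderiv ℝ (f I)) p (eX j) (eX k) := fun j k ↦ by
      unfold dXX VarWave.dX; rw [fderiv_fderiv_apply (hf I)]
    have hQ : ∀ j k, sliceQOf (waveBasis 3) (Ĝ p) j k =
        ginv Ĝ (waveBasis 3) p (some j) (some k)
          - ginv Ĝ (waveBasis 3) p none (some j) * ginv Ĝ (waveBasis 3) p none (some k)
            / ginv Ĝ (waveBasis 3) p none none := fun j k ↦ rfl
    have hg0 : ∀ i, ginv Ĝ (waveBasis 3) p (some i) none = ginv Ĝ (waveBasis 3) p none (some i) :=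
      fun i ↦ hgs _ _
    have hD0 : ∀ i, fderiv ℝ (fderiv ℝ (f I)) p eT (eX i) = fderiv ℝ (fderiv ℝ (f I)) p (eX i) eT :=
      fun i ↦ hD2 _ _
    unfold WaveFrame.P
    simp only [Pi.zero_apply, zero_mul, Finset.sum_const_zero, add_zero, hTT, hTX, hXX, waveCoeffs,
      hQ]
    simp only [Fintype.sum_option, Fin.sum_univ_three, waveBasis_none, waveBasis_some, hg0, hD0]
    field_simp
    ring
  · -- the lower-order part
    rw [tlapLower_eq_sum]
    unfold WaveSystem.Coeffs.cpl
    simp only [waveCoeffs, Fintype.sum_option, waveBasis_none, waveBasis_some]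
    simp only [Finset.sum_add_distrib]
    have hT : ∀ J, fderiv ℝ (f J) p eT = VarWave.dT (f J) p := fun J ↦ rfl
    have hX : ∀ J j, fderiv ℝ (f J) p (eX j) = VarWave.dX (f J) j p := fun J j ↦ rfl
    simp only [hT, hX]
    rw [Finset.sum_comm (s := (Finset.univ : Finset (Fin 3)))]
    have e1 : ∑ J, f J p * lowerCoef0 Ĝ (waveBasis 3) p I J =
        ∑ J, lowerCoef0 Ĝ (waveBasis 3) p I J * f J p :=
      Finset.sum_congr rfl fun J _ ↦ by ring
    have e2 : ∑ J, VarWave.dT (f J) p * lowerCoef1 Ĝ (waveBasis 3) p I none J =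
        ∑ J, lowerCoef1 Ĝ (waveBasis 3) p I none J * VarWave.dT (f J) p :=
      Finset.sum_congr rfl fun J _ ↦ by ring
    have e7 : ∑ J, ∑ j, VarWave.dX (f J) j p * lowerCoef1 Ĝ (waveBasis 3) p I (some j) J =
        ∑ J, ∑ j, lowerCoef1 Ĝ (waveBasis 3) p I (some j) J * VarWave.dX (f J) j p :=
      Finset.sum_congr rfl fun J _ ↦ Finset.sum_congr rfl fun j _ ↦ by ring
    rw [e1, e2, e7]
    ring

end Equation

/-! ### Local existence near a slice point -/

section Existence

variable {α : Type*} [Fintype α] [DecidableEq α] {G : Pt 3 → Pt 3 →L[ℝ] Pt 3 →L[ℝ] ℝ}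
  {T : Set (Pt 3)}

/-- **Local existence for linear tensor wave equations near a slice point.** Let `G` be smooth,
symmetric and nondegenerate on the open set `T ⊆ ℝ × ℝ³` and slice-hyperbolic at `(0, x₀) ∈ T`.
There is `r > 0` with `B((0,x₀), r) ⊆ T` such that for all `C_c^∞` Cauchy data `(S₀, S₁)` there is
a smooth rank-`α` tensor field `S` on `ℝ × ℝ³` with `S(0, ·) = S₀`, `∂_t S(0, ·) = S₁`, solving
`□_G S = 0` on a neighbourhood of every point `(0, y) ∈ B((0,x₀), r)` (Hawking–Ellis 1973, §7.4,
via Friedrichs 1954 and John 1982, Ch. 5 §3).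
[cite: HawkingEllis1973CUP, §7.4] [cite: Friedrichs1954, §§1–4] [cite: John1982, Ch. 5 §3] -/
theorem IsMetricOn.exists_tensorWave_solution (hG : IsMetricOn G T) {x₀ : EuclideanSpace ℝ (Fin 3)}
    (hx₀ : (((0 : ℝ), x₀) : Pt 3) ∈ T) (hhyp : IsSliceHyperbolic (waveBasis 3) (G ((0 : ℝ), x₀))) :
    ∃ r, 0 < r ∧ ball (((0 : ℝ), x₀) : Pt 3) r ⊆ T ∧
      ∀ (S₀ S₁ : EuclideanSpace ℝ (Fin 3) → (α → Option (Fin 3)) → ℝ),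
        (∀ I, ContDiff ℝ ∞ fun y ↦ S₀ y I) → (∀ I, ContDiff ℝ ∞ fun y ↦ S₁ y I) →
        (∀ I, HasCompactSupport fun y ↦ S₀ y I) → (∀ I, HasCompactSupport fun y ↦ S₁ y I) →
        ∃ S : Pt 3 → (α → Option (Fin 3)) → ℝ, (∀ I, ContDiff ℝ ∞ fun p ↦ S p I) ∧
          (∀ y : EuclideanSpace ℝ (Fin 3), (((0 : ℝ), y) : Pt 3) ∈ ball (((0 : ℝ), x₀) : Pt 3) r →
            ∀ᶠ p in 𝓝 (((0 : ℝ), y) : Pt 3), ∀ I, tlap G (waveBasis 3) S p I = 0) ∧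
          (∀ y I, S ((0 : ℝ), y) I = S₀ y I) ∧
          (∀ y I, fderiv ℝ (fun p ↦ S p I) ((0 : ℝ), y) eT = S₁ y I) := by
  -- the cut-off metric
  obtain ⟨Ĝ, hĜ, ⟨r, hr, hrT, hrG⟩, ⟨R, hR⟩, hhypĜ⟩ :=
    hG.exists_sliceHyperbolic_cutoff (waveBasis 3) hx₀ hhyp
  refine ⟨r, hr, hrT, fun S₀ S₁ h₀ h₁ c₀ c₁ ↦ ?_⟩
  -- the coefficient data and their regularity
  set C := waveCoeffs (α := α) Ĝ with hC
  have hCs : C.IsSmooth := isSmooth_waveCoeffs hĜ hhypĜ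
  obtain ⟨cA, cB, hflatA, hflatB⟩ := waveCoeffs_flat (α := α) (Ĝ := Ĝ) hR
  have hreg : IsRegularSymmCoeffFamily (fun j t (x : EuclideanSpace ℝ (Fin 3)) ↦ C.Aop j ((t, x) : Pt 3))
      (fun t (x : EuclideanSpace ℝ (Fin 3)) ↦ C.Bop ((t, x) : Pt 3)) :=
    isRegularSymmCoeffFamily_of_flat (fun j ↦ WaveSystem.Coeffs.contDiff_Aop hCs j)
      (WaveSystem.Coeffs.contDiff_Bop hCs) (fun j p u w ↦ C.inner_Aop_comm j p u w) hflatA hflatB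
  -- Friedrichs' theorem for the component system
  obtain ⟨f, hfs, hf0, hf1, hfeq⟩ := WaveSystem.exists_solution hCs hreg
    (f₀ := fun K y ↦ S₀ y K) (f₁ := fun K y ↦ S₁ y K) (fun K ↦ h₀ K) (fun K ↦ h₁ K)
    (fun K ↦ c₀ K) (fun K ↦ c₁ K)
  refine ⟨fun p I ↦ f I p, hfs, fun y hy ↦ ?_, fun y I ↦ hf0 I y, fun y I ↦ hf1 I y⟩
  -- the equation near the slice points of the ball
  have hball : ∀ᶠ p in 𝓝 (((0 : ℝ), y) : Pt 3), p ∈ ball (((0 : ℝ), x₀) : Pt 3) r :=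
    isOpen_ball.mem_nhds hy
  filter_upwards [hfeq y, hball] with p hp hpb I
  have hGG : ∀ q ∈ ball (((0 : ℝ), x₀) : Pt 3) r, G q = Ĝ q := fun q hq ↦ (hrG q hq).symm
  rw [tlap_congr_of_eqOn (waveBasis 3) isOpen_ball hGG hpb (fun q J ↦ f J q) I,
    tlap_eq_P_add_cpl hĜ hhypĜ hfs p I]
  exact hp I

end Existence

end MetricCoord

end Literature.Geometry.Lorentzian

end
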